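import Mathlib
import Summits.ResolutionOfSingularities.ResolutionOfSingularities.Theorems.IndSmoothValuativeSmoothingFieldTargets
import Summits.ResolutionOfSingularities.ResolutionOfSingularities.Theorems.IndSmoothValuativeSmoothingFrobeniusDecomposition
import Summits.ResolutionOfSingularities.ResolutionOfSingularities.Theorems.IndSmoothValuativeSmoothingValuationSeparability
import Literature.AlgebraicGeometry.Resolution.SmoothFactorizationsTransport
import HarnessLib

/-!
# TopLevel — PT at the top of the chain
# (crux `IndSmooth.ValuativeSmoothing`, stmt-ResolutionOfSingularities-16087, line `birth`,
# lead c1 devissage programme "discrete jumps", wave 2: stub E4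
# `hasSmoothFactorizations_of_valuation_of_eq_top`)

## What is proved

Let `k` be a perfect field of characteristic `p > 0`, `K / k` a field extension, `a : ι → K` a
finite family and `F := k(a) = IntermediateField.adjoin k (Set.range a)`.  Let `W` be a
valuation ring of `K` for which the monomials `a ^ α = ∏ i, a i ^ α i`, `α : ι → Fin p`, have
`W`-valuations that are pairwise distinct modulo values of `p`-th powers (`hind`), and let `O`
be a valuation ring of `K` that is all of `K` (`hO`), carrying an `F`-algebra structure
compatible with `F ⊆ K` (`IsScalarTower F O K`).  Then PT holds for `F → O`
(`Literature.AlgebraicGeometry.Resolution.HasSmoothFactorizations F O`, Stacks Tag 07F2 in the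
factorisation form of Tag 07C3 (2)): every `F`-algebra map `A → O` with `A` of finite type over
`F` factors through a smooth `F`-algebra.  This is the coarsest level of the lead's slicing
induction, where the valuation ring is the whole field and ind-smoothness of `K / F` is the
separability of `K / F` forced by the valuation independence of the generators.

## Proof

A composition of the three landed sibling stubs with a transport:

* `F = F ^ p [a]` because `k` is perfect (stub C1, `exists_sum_frobenius_mul_monomial`);
* hence, by Mac Lane's criterion fed with `hind`, `Frac B` is formally smooth over `F` for every
  finitely generated `F`-subalgebra `B ⊆ K` (stub C2,
  `formallySmooth_fractionRing_of_valuation`);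
* hence PT holds for the field target `F → K` (stub B,
  `hasSmoothFactorizations_field_of_formallySmooth`, the separable case of Stacks Tag 07BV);
* finally `x ↦ ⟨x, hO x⟩` is a ring isomorphism `K ≃ O` (inverse: the coercion), and it is an
  `F`-algebra isomorphism precisely by `IsScalarTower.algebraMap_apply F O K`; PT is invariant
  under `F`-algebra isomorphisms of the target (`HasSmoothFactorizations.of_algEquiv`).

## Design notes

The isomorphism `K ≃+* O` is written out as a structure (all fields `rfl`) rather than through
`O.toSubring = ⊤` and `Subring.topEquiv`, which keeps the compatibility proof a one-line
`Subtype.ext`.  The hypothesis `hO` is used there, `W` and `hind` only enter through stub C2.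
-/

-- single-problem summit: the doubled namespace component is forced
set_option linter.dupNamespace false

open scoped TensorProduct

namespace Summit.ResolutionOfSingularities.ResolutionOfSingularities.Theorems.ValuativeSmoothing

open Literature.AlgebraicGeometry.Resolution

/-- Stub E4: PT at the top of the chain — the whole field (as the valuation subring `O = ⊤`)
is ind-smooth over the subfield generated by all chain generators. -/
theorem hasSmoothFactorizations_of_valuation_of_eq_top (p : ℕ) [Fact p.Prime] (k K : Type)
    [Field k] [CharP k p] [PerfectField k] [Field K] [Algebra k K]
    (W O : ValuationSubring K) (hO : ∀ x : K, x ∈ O) {ι : Type} [Fintype ι] [DecidableEq ι]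
    (a : ι → K)
    (hind : ∀ α β : ι → Fin p, α ≠ β → ∀ h : K,
      W.valuation (∏ i, a i ^ (α i : ℕ)) ≠ W.valuation (h ^ p * ∏ i, a i ^ (β i : ℕ)))
    [Algebra (IntermediateField.adjoin k (Set.range a)) O]
    [IsScalarTower (IntermediateField.adjoin k (Set.range a)) O K] :
    Literature.AlgebraicGeometry.Resolution.HasSmoothFactorizations (IntermediateField.adjoin k
      (Set.range a)) O := by
  -- `F = F ^ p [a]` since `k` is perfect (stub C1)
  have hdec : ∀ x ∈ IntermediateField.adjoin k (Set.range a), ∃ c : (ι → Fin p) → K,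
      (∀ α, c α ∈ IntermediateField.adjoin k (Set.range a)) ∧
      x = ∑ α : ι → Fin p, c α ^ p * ∏ i, a i ^ ((α i : ℕ)) :=
    fun x hx => exists_sum_frobenius_mul_monomial p k K a x hx
  -- PT for the field target `F → K`: generic formal smoothness (stub C2) and stub B
  have hK : HasSmoothFactorizations (IntermediateField.adjoin k (Set.range a)) K :=
    hasSmoothFactorizations_field_of_formallySmooth _ K fun B hB =>
      formallySmooth_fractionRing_of_valuation p k K a W hind hdec B hB
  -- transport along the `F`-algebra isomorphism `K ≃ O`, `x ↦ ⟨x, hO x⟩`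
  let e₀ : K ≃+* O :=
    { toFun := fun x => ⟨x, hO x⟩
      invFun := fun x => x
      left_inv := fun _ => rfl
      right_inv := fun _ => rfl
      map_mul' := fun _ _ => rfl
      map_add' := fun _ _ => rfl }
  have he : ∀ x : IntermediateField.adjoin k (Set.range a),
      e₀ (algebraMap (IntermediateField.adjoin k (Set.range a)) K x) =
        algebraMap (IntermediateField.adjoin k (Set.range a)) O x := by
    intro x
    apply Subtype.ext
    change algebraMap (IntermediateField.adjoin k (Set.range a)) K x =
      ((algebraMap (IntermediateField.adjoin k (Set.range a)) O x : O) : K)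
    exact IsScalarTower.algebraMap_apply (IntermediateField.adjoin k (Set.range a)) O K x
  exact hK.of_algEquiv (AlgEquiv.ofRingEquiv (f := e₀) he)

end Summit.ResolutionOfSingularities.ResolutionOfSingularities.Theorems.ValuativeSmoothing
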